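import Mathlib.Analysis.Calculus.BumpFunction.InnerProduct
import Mathlib.Analysis.Calculus.BumpFunction.Basic
import Literature.Analysis.FluidPDE.CoordDerivatives
import Literature.Analysis.FluidPDE.HomogeneousEuler
import HarnessLib

/-!
# Šverák's classification of `(−1)`-homogeneous steady Navier–Stokes flows — localisation tools

Analysis/FluidPDE support file, third of the series `SverakLandau*` proving the named fact
`Literature.Analysis.FluidPDE.Sverak2011_landauClassification` (V. Šverák, J. Math. Sci. 179
(2011) = arXiv:math/0604550, Thm. 1).

Šverák's theorem is about fields smooth on `ℝ³ ∖ {0}` only, while the tree's coordinate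
calculus (`CoordDerivatives`: `pderiv l f = ∂ₗf` with its Leibniz and Schwarz rules) and
integration-by-parts lemmas are stated for globally smooth functions.  This file provides the
(folklore) bridge used by every later file of the series:

* `Sverak2011.exists_contDiff_eq_of_contDiffOn` — **cut-off regularisation**: a function `Cⁿ`
  on `{x | x ≠ 0}` agrees on `{x | δ ≤ |x|}` (`δ > 0`) with a globally `Cⁿ` function
  (multiply by `1 −` a smooth bump equal to `1` near the origin);
* `Sverak2011.pderiv_congr_of_eventuallyEq`, `Sverak2011.pderiv_eventuallyEq`,
  `Sverak2011.pderiv_eqOn`, `Sverak2011.pderiv_pderiv_eqOn` — partial derivatives of functions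
  that agree near a point / on an open set agree there (so the coordinate identities proved for
  the regularisation transfer back);
* `Sverak2011.pderiv_coord`, `Sverak2011.differentiable_coord` — `∂ₗ yᵢ = δᵢₗ`;
* **Euler's relations in coordinates**: `Sverak2011.sum_mul_pderiv_comp_eq` turns the vector
  relation `DU(y) y = k U(y)` into `∑ⱼ yⱼ ∂ⱼUᵢ(y) = k Uᵢ(y)`, and
  `Sverak2011.euler_pderiv` differentiates an Euler relation holding on an open set:
  `∑ⱼ yⱼ∂ⱼf = k f` on `S` implies `∑ⱼ yⱼ∂ⱼ(∂ₗf) = (k − 1) ∂ₗf` on `S` (derivatives of a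
  homogeneous function are homogeneous of one degree less);
* `Sverak2011.fderiv_apply_self_of_neg_one_homogeneous` — Euler's relation `Du(x) x = −u(x)`
  for the scaling `t u(tx) = u(x)` of Šverák's theorem (via the tree's
  `fderiv_apply_self_of_smul_eq_rpow_smul`).

## References

* V. Šverák, *On Landau's solutions of the Navier–Stokes equations*, J. Math. Sci. 179 (2011)
  208–228, arXiv:math/0604550, §4 and Appendix 1 (homogeneous fields `u = (v + f e)/r`).
  [`Sverak2011`]
-/

noncomputable section

open Set Filter Metric
open scoped Topology BigOperators ContDiff

namespace Literature.Analysis.FluidPDE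

namespace Sverak2011

/-! ### Cut-off regularisation near the origin -/

section Cutoff

variable {E : Type*} [NormedAddCommGroup E] [InnerProductSpace ℝ E]
  {F' : Type*} [NormedAddCommGroup F'] [NormedSpace ℝ F']

/-- **Cut-off regularisation.** A function of class `Cⁿ` on `{x | x ≠ 0}` coincides on
`{x | δ ≤ |x|}` (`δ > 0`) with a globally `Cⁿ` function: `g = (1 − η) f` with `η` a smooth bump
equal to `1` on `B(0, δ/2)` and supported in `B(0, δ)`. [folklore] -/
theorem exists_contDiff_eq_of_contDiffOn {n : ℕ∞} {f : E → F'}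
    (hf : ContDiffOn ℝ n f {x | x ≠ 0}) {δ : ℝ} (hδ : 0 < δ) :
    ∃ g : E → F', ContDiff ℝ n g ∧ ∀ x, δ ≤ ‖x‖ → g x = f x := by
  let η : ContDiffBump (0 : E) := ⟨δ / 2, δ, by positivity, by linarith⟩
  refine ⟨fun x => (1 - η x) • f x, ?_, fun x hx => ?_⟩
  · rw [contDiff_iff_contDiffAt]
    intro x
    by_cases hx : x = 0
    · subst hx
      have hev : (fun y => (1 - η y) • f y) =ᶠ[𝓝 (0 : E)] fun _ => 0 := by
        filter_upwards [ball_mem_nhds (0 : E) (by positivity : (0 : ℝ) < δ / 2)] with y hy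
        rw [η.one_of_mem_closedBall (ball_subset_closedBall hy), sub_self, zero_smul]
      exact contDiffAt_const.congr_of_eventuallyEq hev
    · exact (contDiffAt_const.sub η.contDiffAt).smul
        (hf.contDiffAt (isOpen_compl_singleton.mem_nhds hx))
  · have h0 : η x = 0 := η.zero_of_le_dist (by simpa using hx)
    simp [h0]

omit [InnerProductSpace ℝ E] [NormedAddCommGroup F'] [NormedSpace ℝ F'] in
/-- The regularisation agrees with `f` near every point of the open set `{x | δ < |x|}`. [folklore] -/
theorem eventuallyEq_of_eq_of_le_norm {F' : Type*} {f g : E → F'} {δ : ℝ}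
    (hg : ∀ x, δ ≤ ‖x‖ → g x = f x) {x : E} (hx : δ < ‖x‖) : g =ᶠ[𝓝 x] f := by
  have ho : IsOpen {y : E | δ < ‖y‖} := isOpen_lt continuous_const continuous_norm
  filter_upwards [ho.mem_nhds hx] with y hy
  exact hg y (le_of_lt hy)

end Cutoff

/-! ### Partial derivatives of functions that agree locally -/

section Congr

variable {ι : Type*} [Fintype ι] [DecidableEq ι]

omit [Fintype ι] in
/-- Functions that agree near `x` have the same partial derivatives at `x`. [folklore] -/
theorem pderiv_congr_of_eventuallyEq {f g : EuclideanSpace ℝ ι → ℝ} {x : EuclideanSpace ℝ ι}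
    (h : f =ᶠ[𝓝 x] g) (l : ι) : pderiv l f x = pderiv l g x := by
  rw [pderiv_apply, pderiv_apply, h.fderiv_eq]

omit [Fintype ι] in
/-- Functions that agree near `x` have partial derivatives that agree near `x`. [folklore] -/
theorem pderiv_eventuallyEq {f g : EuclideanSpace ℝ ι → ℝ} {x : EuclideanSpace ℝ ι}
    (h : f =ᶠ[𝓝 x] g) (l : ι) : pderiv l f =ᶠ[𝓝 x] pderiv l g := by
  filter_upwards [h.eventuallyEq_nhds] with y hy
  exact pderiv_congr_of_eventuallyEq hy l

omit [Fintype ι] in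
/-- Functions that agree on an open set have the same partial derivatives there. [folklore] -/
theorem pderiv_eqOn {f g : EuclideanSpace ℝ ι → ℝ} {S : Set (EuclideanSpace ℝ ι)}
    (hS : IsOpen S) (h : EqOn f g S) (l : ι) : EqOn (pderiv l f) (pderiv l g) S :=
  fun _ hx => pderiv_congr_of_eventuallyEq (h.eventuallyEq_of_mem (hS.mem_nhds hx)) l

omit [Fintype ι] in
/-- Functions that agree on an open set have the same second partial derivatives there. [folklore] -/
theorem pderiv_pderiv_eqOn {f g : EuclideanSpace ℝ ι → ℝ} {S : Set (EuclideanSpace ℝ ι)}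
    (hS : IsOpen S) (h : EqOn f g S) (k l : ι) :
    EqOn (pderiv k (pderiv l f)) (pderiv k (pderiv l g)) S :=
  pderiv_eqOn hS (pderiv_eqOn hS h l) k

omit [Fintype ι] in
/-- A function vanishing on an open set has vanishing partial derivatives there. [folklore] -/
theorem pderiv_eq_zero_of_eqOn_zero {f : EuclideanSpace ℝ ι → ℝ} {S : Set (EuclideanSpace ℝ ι)}
    (hS : IsOpen S) (h : ∀ x ∈ S, f x = 0) (l : ι) {x : EuclideanSpace ℝ ι} (hx : x ∈ S) :
    pderiv l f x = 0 := by
  rw [pderiv_eqOn hS (g := fun _ => (0 : ℝ)) (fun y hy => h y hy) l hx, pderiv_const]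

/-! ### Coordinate functions -/

omit [Fintype ι] [DecidableEq ι] in
/-- The coordinate functions `y ↦ yᵢ` are differentiable. [folklore] -/
theorem differentiable_coord (i : ι) : Differentiable ℝ fun y : EuclideanSpace ℝ ι => y i :=
  (EuclideanSpace.proj i : EuclideanSpace ℝ ι →L[ℝ] ℝ).differentiable

omit [DecidableEq ι] in
/-- The coordinate functions `y ↦ yᵢ` are smooth. [folklore] -/
theorem contDiff_coord (i : ι) {n : WithTop ℕ∞} :
    ContDiff ℝ n fun y : EuclideanSpace ℝ ι => y i :=
  (EuclideanSpace.proj i : EuclideanSpace ℝ ι →L[ℝ] ℝ).contDiff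

/-- `∂ₗ yᵢ = δᵢₗ`. [folklore] -/
theorem pderiv_coord (i l : ι) (y : EuclideanSpace ℝ ι) :
    pderiv l (fun z : EuclideanSpace ℝ ι => z i) y = if i = l then 1 else 0 := by
  rw [pderiv_apply]
  have : (fun z : EuclideanSpace ℝ ι => z i) =
      (EuclideanSpace.proj i : EuclideanSpace ℝ ι →L[ℝ] ℝ) := rfl
  rw [this, ContinuousLinearMap.fderiv]
  simp

/-! ### Euler's relations in coordinates -/

/-- **Euler's relation in coordinates.** If `DU(y) y = k U(y)` for a field `U` differentiable at
`y`, then `∑ⱼ yⱼ ∂ⱼUᵢ(y) = k Uᵢ(y)` for every component `i`. [folklore] -/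
theorem sum_mul_pderiv_comp_eq {U : EuclideanSpace ℝ ι → EuclideanSpace ℝ ι}
    {y : EuclideanSpace ℝ ι} {k : ℝ} (hU : DifferentiableAt ℝ U y)
    (h : fderiv ℝ U y y = k • U y) (i : ι) :
    ∑ j, y j * pderiv j (fun z => U z i) y = k * U y i := by
  have := congrArg (fun w : EuclideanSpace ℝ ι => w i) h
  simp only [PiLp.smul_apply, smul_eq_mul] at this
  rw [euclidean_fderiv_apply_comp hU] at this
  rw [← this]
  -- expand the direction `y` in the standard basis
  have e : y = ∑ j, y j • (stdVec j : EuclideanSpace ℝ ι) := by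
    conv_lhs => rw [← (EuclideanSpace.basisFun ι ℝ).sum_repr y]
    simp [stdVec, EuclideanSpace.basisFun_apply]
  rw [congrArg (fderiv ℝ (fun z => U z i) y) e, map_sum]
  refine Finset.sum_congr rfl fun j _ => ?_
  rw [map_smul, smul_eq_mul, pderiv_apply]

/-- **Euler's relation for a derivative.** If a smooth `f` satisfies `∑ⱼ yⱼ ∂ⱼf(y) = k f(y)` on
an open set `S` (infinitesimal homogeneity of degree `k`), then every partial derivative is
infinitesimally homogeneous of degree `k − 1` there: `∑ⱼ yⱼ ∂ⱼ(∂ₗf)(y) = (k − 1) ∂ₗf(y)` on `S`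
(differentiate the relation and use Schwarz). [folklore] -/
theorem euler_pderiv {f : EuclideanSpace ℝ ι → ℝ} (hf : ContDiff ℝ ∞ f)
    {S : Set (EuclideanSpace ℝ ι)} (hS : IsOpen S) {k : ℝ}
    (h : ∀ y ∈ S, ∑ j, y j * pderiv j f y = k * f y) (l : ι) {y : EuclideanSpace ℝ ι}
    (hy : y ∈ S) : ∑ j, y j * pderiv j (pderiv l f) y = (k - 1) * pderiv l f y := by
  have hfd : Differentiable ℝ f := hf.differentiable (by simp)
  have hdf : ∀ j, Differentiable ℝ (pderiv j f) := fun j =>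
    (contDiff_pderiv hf j).differentiable (by simp)
  -- the defect `g = ∑ⱼ yⱼ∂ⱼf − k f` vanishes on `S`, hence so does `∂ₗ g`
  have hg0 := pderiv_eq_zero_of_eqOn_zero hS
    (f := fun y => ∑ j, y j * pderiv j f y - k * f y) (fun y hy => by rw [h y hy, sub_self]) l hy
  rw [pderiv_sub (f := fun y => ∑ j, y j * pderiv j f y) (g := fun y => k * f y)
      (Differentiable.fun_sum fun j _ => (differentiable_coord j).mul (hdf j)) (hfd.const_mul k),
    pderiv_sum (f := fun j y => y j * pderiv j f y) _
      (fun j _ => (differentiable_coord j).mul (hdf j)),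
    pderiv_const_mul (f := f) hfd] at hg0
  beta_reduce at hg0
  have hprod : ∀ j, pderiv l (fun y : EuclideanSpace ℝ ι => y j * pderiv j f y) y =
      (if j = l then 1 else 0) * pderiv j f y + y j * pderiv j (pderiv l f) y := by
    intro j
    rw [pderiv_mul (differentiable_coord j) (hdf j)]
    beta_reduce
    rw [pderiv_coord, pderiv_comm hf l j]
  simp only [hprod, Finset.sum_add_distrib, ite_mul, one_mul, zero_mul, Finset.sum_ite_eq',
    Finset.mem_univ, if_true] at hg0
  linarith

/-- Euler's relation `Du(x) x = −u(x)` (`x ≠ 0`) for a field with Šverák's scaling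
`t u(t x) = u(x)` (`t > 0`) which is differentiable at `x`. [folklore] -/
theorem fderiv_apply_self_of_neg_one_homogeneous {E : Type*} [NormedAddCommGroup E]
    [NormedSpace ℝ E] {F : Type*} [NormedAddCommGroup F] [NormedSpace ℝ F] {u : E → F} {x : E}
    (hhom : ∀ t : ℝ, 0 < t → t • u (t • x) = u x) (hd : DifferentiableAt ℝ u x) :
    fderiv ℝ u x x = -u x := by
  have h := fderiv_apply_self_of_smul_eq_rpow_smul (Φ := u) (x := x) (m := -1)
    (fun c hc => by
      rw [Real.rpow_neg_one, ← hhom c hc, smul_smul, inv_mul_cancel₀ hc.ne', one_smul]) hd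
  rwa [neg_one_smul] at h

end Congr

end Sverak2011

end Literature.Analysis.FluidPDE
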